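import Summits.BirchSwinnertonDyer.Uniform.U2.GenusCongruence
import Literature.NumberTheory.EllipticCurves.CoatesLiTianZhai2015.HeegnerTraceRelation
import Literature.NumberTheory.EllipticCurves.HeegnerPointsGaloisDescent
import HarnessLib

/-!
# Cell «bsd-uniform», track U2, route C — the genus point over the RING CLASS FIELD `K[q]` has
# infinite order: Theorem A′ (first half) for ONE inert `a_q`-odd prime, ASSEMBLED from the landed
# printed fact `CoatesLiTianZhai2015.traceRelation_inert` (the bridge u2-lit asked for)

HONEST FRAMING (cell «bsd-uniform», run/shared/lean/pub/bsd-uniform/, seat u2-p3): no claim about the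
Birch–Swinnerton-Dyer conjecture; a RELATIVE statement anchored on the per-base datum (H-y); every
arithmetic input an explicit binder. This file is the GLUE between the tree's presentation of ring
class fields (`ringClassField K ι n ⊂ ℂ`, `ringClassGal`, `ringClassGalOver`, `pointGalHom` — all of
`HeegnerPointsOfConductor.lean`) and the abstract algebra of `GenusCongruence.lean`, and it CONSUMES
the printed one-step norm relation AS LANDED (`CoatesLiTianZhai2015.traceRelation_inert`, p338989:
single-level at the top field `K[Mp]`, read in `E(ℂ)`) at `M = 1`: for ONE prime `q ∤ N` inert in `K`
with `a_q` ODD, the genus point `P(χ) = Σ_{σ ∈ Gal(K[q]/K)} χ(σ)·σ y_q ∈ E(K[q])` has infinite order.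
Inputs and status:
* PRINTED, landed: `traceRelation_inert` (CLTZ 2015 Lemma 2.9 "general fact"; binders verbatim: `K =
  ℚ(√−ℓ₀)`, `ℓ₀ > 3` prime `≡ 3 (mod 4)` — CLTZ's standing field —, Heegner hypothesis for `N`,
  `q ∤ N` prime, `q` inert).
* PROVED (tree): Galois descent `exists_map_eq_of_forall_map_galois_eq`; here bridged to the
  `ringClassGal` presentation (`exists_map_eq_of_forall_ringClassGal`).
* PROVED (this cell): `GenusCongruence.not_isOfFinAddOrder_genusPoint`, coset fold
  `sum_eq_smul_sum_quotient_of_trace_eq_smul` (no commutativity of `Gal(K[q]/K)` is used).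
* DATA / per-base binders: the `K[q]`-rational points `y` over `x(q)` and `y₁` over `x(1)` (CM
  rationality is data in the tree, cf. `KolyvaginHeegnerData.y`), Gross's (4.1)
  `Tr_{K[1]/K} y₁ = y_K` (`hyK`), (H-y) `y_K ∉ 2E(K)`, L1 `E(K[q])[2] = 0` (`h2L`, RESIDUE R2-9).
Longer `M` (several primes) fold by `GenusCongruence.sum_quotient_eq_smul_of_rel` once the restriction
API `Aut_ℚ(K[n]) → Aut_ℚ(K[m])` between DIFFERENT ambient ring class fields exists (u2-lit's answer
L-C1, INBOX 19:36Z); this file does the one-prime case, where top field = `K[q]` and no restriction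
is needed.

References: Coates–Li–Tian–Zhai, PLMS 110 (2015) Lemma 2.9 [CoatesLiTianZhai2015]; Gross, LMS LNS 153
(1991) §4 (4.1) [GrossLMS1991]; T4-PROOF.md v1.9b §3 L2′, §4 Thm A.
-/

noncomputable section

open scoped Classical

open WeierstrassCurve NumberField Literature.NumberTheory.EllipticCurves
  Literature.NumberTheory.EllipticCurves.ModularForms

set_option autoImplicit false

namespace Summit.BirchSwinnertonDyer.Uniform.U2.RingClass

universe u

section Bridge

variable {K : Type} [Field K] [NumberField K] (ι : K →+* ℂ) (n : ℕ) (W : WeierstrassCurve ℚ)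

/-- A `K`-algebra automorphism of `K[n]`, viewed as a `ℚ`-algebra automorphism, lies in
`𝒢_n = Gal(K[n]/K)` (it fixes `ι(K)` pointwise). [folklore] -/
theorem restrictScalars_mem_ringClassGal (τ : ringClassField K ι n ≃ₐ[K] ringClassField K ι n) :
    τ.restrictScalars ℚ ∈ ringClassGal ι n := by
  rw [ringClassGal, mem_fixingSubgroup_iff]
  rintro x ⟨k, hk⟩
  have hx : x = algebraMap K (ringClassField K ι n) k := Subtype.ext (by rw [← hk]; rfl)
  rw [hx]
  exact τ.commutes k

/-- Elements of `𝒢_n` fix the image of every `K`-point of `E` in `E(K[n])`. [folklore] -/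
theorem pointGalHom_map_eq_of_mem_ringClassGal {σ : ringClassField K ι n ≃ₐ[ℚ] ringClassField K ι n}
    (hσ : σ ∈ ringClassGal ι n) (P : (W.baseChange K).toAffine.Point) :
    pointGalHom W (ringClassField K ι n) σ
        (WeierstrassCurve.Affine.Point.map (W' := W)
          (algebraMap K (ringClassField K ι n)).toRatAlgHom P) =
      WeierstrassCurve.Affine.Point.map (W' := W) (algebraMap K (ringClassField K ι n)).toRatAlgHom P := by
  rw [pointGalHom_apply, WeierstrassCurve.Affine.Point.map_map]
  have hcomp : (σ : ringClassField K ι n →ₐ[ℚ] ringClassField K ι n).comp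
      (algebraMap K (ringClassField K ι n)).toRatAlgHom =
      (algebraMap K (ringClassField K ι n)).toRatAlgHom := by
    apply AlgHom.ext
    intro k
    exact smul_algebraMap_of_mem_ringClassGal hσ k
  rw [hcomp]

/-- **Galois descent in the `ringClassGal` presentation**: a point of `E(K[n])` fixed by every
element of `𝒢_n = Gal(K[n]/K)` is the image of a point of `E(K)` (`K` imaginary quadratic, `n ≠ 0`,
so `K[n]/K` is Galois — tree theorem `finiteDimensional_and_isGalois_ringClassField` — and the
tree's descent `exists_map_eq_of_forall_map_galois_eq` applies to `Gal(K[n]/K)` realised as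
`K`-algebra automorphisms). [cite: SilvermanAEC2009, I.§1 and VIII.§1] -/
theorem exists_map_eq_of_forall_ringClassGal (hK : IsImaginaryQuadratic K) (hn : n ≠ 0)
    {R : (W.baseChange (ringClassField K ι n : Type)).toAffine.Point}
    (hR : ∀ σ : ringClassGal ι n, pointGalHom W (ringClassField K ι n) σ.1 R = R) :
    ∃ R₀ : (W.baseChange K).toAffine.Point,
      WeierstrassCurve.Affine.Point.map (W' := W) (algebraMap K (ringClassField K ι n)).toRatAlgHom R₀ =
        R := by
  haveI := (finiteDimensional_and_isGalois_ringClassField hK ι hn).2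
  obtain ⟨R₀, hR₀⟩ := exists_map_eq_of_forall_map_galois_eq (k := K) W (P := R) (fun τ => by
    have h := hR ⟨τ.restrictScalars ℚ, restrictScalars_mem_ringClassGal ι n τ⟩
    rw [pointGalHom_apply] at h
    exact h)
  exact ⟨R₀, hR₀⟩

/-- (H-y) lifted to the ring class field: if `y_K ∈ E(K)` is not twice a point of `E(K)`, then its
image in `E(K[n])` is not twice a `Gal(K[n]/K)`-FIXED point (Galois descent + injectivity of
`E(K) → E(K[n])`). [folklore] -/
theorem not_exists_fixed_two_nsmul_eq (hK : IsImaginaryQuadratic K) (hn : n ≠ 0)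
    (yK : (W.baseChange K).toAffine.Point)
    (hHy : ¬ ∃ R₀ : (W.baseChange K).toAffine.Point, (2 : ℕ) • R₀ = yK) :
    ¬ ∃ R : (W.baseChange (ringClassField K ι n : Type)).toAffine.Point,
      (∀ σ : ringClassGal ι n, pointGalHom W (ringClassField K ι n) σ.1 R = R) ∧
        (2 : ℕ) • R = WeierstrassCurve.Affine.Point.map (W' := W)
          (algebraMap K (ringClassField K ι n)).toRatAlgHom yK := by
  rintro ⟨R, hRfix, hR2⟩
  obtain ⟨R₀, hR₀⟩ := exists_map_eq_of_forall_ringClassGal ι n W hK hn (R := R) hRfix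
  apply hHy
  refine ⟨R₀, ?_⟩
  apply WeierstrassCurve.Affine.Point.map_injective (W' := W)
    (f := (algebraMap K (ringClassField K ι n)).toRatAlgHom)
  rw [map_nsmul, hR₀, hR2]

/-- Pull an `E(ℂ)`-valued trace identity over `Gal(K[n]/K[m])` (the currency of the landed fact
`CoatesLiTianZhai2015.traceRelation_inert`) back to `E(K[n])` along the injection `E(K[n]) → E(ℂ)`.
[folklore] -/
theorem sum_pointGalHom_eq_smul_of_finsum (m : ℕ) [Fintype (ringClassGalOver ι n m)]
    (y y₁ : (W.baseChange (ringClassField K ι n : Type)).toAffine.Point) (a : ℤ)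
    (h : ∑ᶠ σ ∈ (ringClassGalOver ι n m :
        Set (ringClassField K ι n ≃ₐ[ℚ] ringClassField K ι n)),
        WeierstrassCurve.Affine.Point.map (ringClassField K ι n).subtype.toRatAlgHom
          (pointGalHom W (ringClassField K ι n) σ y) =
      a • WeierstrassCurve.Affine.Point.map (ringClassField K ι n).subtype.toRatAlgHom y₁) :
    ∑ τ : ringClassGalOver ι n m, pointGalHom W (ringClassField K ι n) τ.1 y = a • y₁ := by
  apply WeierstrassCurve.Affine.Point.map_injective (W' := W)
    (f := (ringClassField K ι n).subtype.toRatAlgHom)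
  rw [map_sum, map_zsmul, ← h, ← finsum_set_coe_eq_finsum_mem, finsum_eq_sum_of_fintype]
  exact Fintype.sum_equiv (Equiv.refl _) _ _ (fun _ => rfl)

end Bridge

/-! ## The genus point of ONE inert `a_q`-odd prime has infinite order (Theorem A′, first half,
assembled from the landed CLTZ fact) -/

/-- **`P(χ) ∉ E(K[q])_tors` for one inert `a_q`-odd prime `q`.** Printed binders (verbatim those of
`CoatesLiTianZhai2015.traceRelation_inert` at `M = 1`): `E/ℚ` globally minimal of conductor `N`,
`K = ℚ(√−ℓ₀)` imaginary quadratic with `ℓ₀ > 3` prime, `ℓ₀ ≡ 3 (mod 4)`, `d_K = −ℓ₀` (CLTZ's standing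
field, referee V4 F-A1) and the Heegner hypothesis for `N`, `ι : K → ℂ`, a
parametrisation datum `Dt` and orientation `β` (`β² ≡ d_K mod 4N`), a prime `q ∤ N` INERT in `K`;
data: `y ∈ E(K[q])` over `x(q)` and `y₁ ∈ E(K[q])` over `x(1)` (complex images pinned by
`heegnerPointComplexOfConductor`), `y_K ∈ E(K)` with Gross's (4.1) `Tr_{K[1]/K} y₁ = y_K` read in
`E(K[q])` (`hyK`); hypotheses: `a_q` ODD, L1 `E(K[q])[2] = 0` (`h2L`), (H-y) `y_K ∉ 2E(K)`; `s` any
sign function on `Gal(K[q]/K)` (the genus character `χ_q`). Then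
`P(s) = Σ_{σ ∈ Gal(K[q]/K)} s(σ)·σy` has infinite order. Chain: CLTZ's relation in `E(ℂ)` ⇒ (injectivity
of `E(K[q]) → E(ℂ)`) `Σ_{Gal(K[q]/K[1])} σy = a_q·y₁` in `E(K[q])` ⇒ (coset fold
`GenusCongruence.sum_eq_smul_sum_quotient_of_trace_eq_smul` + `hyK`) `Σ_{Gal(K[q]/K)} σy = a_q·y_K` ⇒
(`GenusCongruence.not_isOfFinAddOrder_genusPoint` with Galois descent
`exists_map_eq_of_forall_ringClassGal`) the claim. [cite: CoatesLiTianZhai2015, Lemma 2.9]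
[cite: GrossLMS1991, §4 (4.1)] -/
theorem genusPoint_not_isOfFinAddOrder_inert (hCLTZ : CoatesLiTianZhai2015.traceRelation_inert)
    (W : WeierstrassCurve ℚ) [W.IsElliptic] [W.IsGloballyMinimal] [NeZero (W.conductorNorm ℤ)]
    {K : Type} [Field K] [NumberField K] (hK : IsImaginaryQuadratic K)
    (ℓ₀ : ℕ) (hℓ₀ : ℓ₀.Prime) (hℓ₀' : 3 < ℓ₀) (hℓ₀'' : ℓ₀ % 4 = 3)
    (hKℓ₀ : NumberField.discr K = -(ℓ₀ : ℤ))
    (hH : SatisfiesHeegnerHypothesis (W.conductorNorm ℤ) K)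
    (ι : K →+* ℂ) (Dt : ModularParametrizationData W (W.conductorNorm ℤ)) (β : ℤ)
    (hβ : (4 * (W.conductorNorm ℤ : ℤ)) ∣ β ^ 2 - NumberField.discr K)
    (q : ℕ) (hq : q.Prime) (hqC : Nat.Coprime q (W.conductorNorm ℤ))
    (hinert : (Ideal.span {(q : 𝓞 K)}).IsPrime)
    [NumberField (ringClassField K ι (1 * q))]
    (y : (W.baseChange (ringClassField K ι (1 * q) : Type)).toAffine.Point)
    (hy : WeierstrassCurve.Affine.Point.map (ringClassField K ι (1 * q)).subtype.toRatAlgHom y =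
      heegnerPointComplexOfConductor Dt (NumberField.discr K) β (1 * q))
    (y₁ : (W.baseChange (ringClassField K ι (1 * q) : Type)).toAffine.Point)
    (hy₁ : WeierstrassCurve.Affine.Point.map (ringClassField K ι (1 * q)).subtype.toRatAlgHom y₁ =
      heegnerPointComplexOfConductor Dt (NumberField.discr K) β 1)
    (yK : (W.baseChange K).toAffine.Point)
    (hyK : ∑ c : ringClassGal ι (1 * q) ⧸
        (ringClassGalOver ι (1 * q) 1).subgroupOf (ringClassGal ι (1 * q)),
        pointGalHom W (ringClassField K ι (1 * q)) (c.out : ringClassGal ι (1 * q)).1 y₁ =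
      WeierstrassCurve.Affine.Point.map (W' := W)
        (algebraMap K (ringClassField K ι (1 * q))).toRatAlgHom yK)
    (h2L : ∀ Q : (W.baseChange (ringClassField K ι (1 * q) : Type)).toAffine.Point,
      (2 : ℕ) • Q = 0 → Q = 0)
    (hHy : ¬ ∃ R : (W.baseChange K).toAffine.Point, (2 : ℕ) • R = yK)
    (haq : Odd (W.frobeniusTrace q)) (s : ringClassGal ι (1 * q) → ℤˣ) :
    ¬ IsOfFinAddOrder (∑ σ : ringClassGal ι (1 * q), (s σ : ℤ) •
      pointGalHom W (ringClassField K ι (1 * q)) σ.1 y) := by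
  have h1q : 1 * q ≠ 0 := by rw [one_mul]; exact hq.ne_zero
  -- (H-y) lifted to `E(K[q])` and the `Gal(K[q]/K)`-invariance of `y_K` (bridge lemmas)
  have hndiv := not_exists_fixed_two_nsmul_eq ι (1 * q) W hK h1q yK hHy
  have hyfix := fun g : ringClassGal ι (1 * q) =>
    pointGalHom_map_eq_of_mem_ringClassGal ι (1 * q) W g.2 yK
  -- Step 1: the printed relation, `M = 1`, in `E(ℂ)`; Step 2: pulled back to `E(K[q])`
  have hrelC := hCLTZ W K hK ℓ₀ hℓ₀ hℓ₀' hℓ₀'' hKℓ₀ hH ι Dt β hβ 1 one_ne_zero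
    (Nat.coprime_one_left _) q hq
    (by rw [one_mul]; exact hqC) hinert y hy
  rw [← hy₁] at hrelC
  have hrelL := sum_pointGalHom_eq_smul_of_finsum ι (1 * q) W 1 y y₁ (W.frobeniusTrace q) hrelC
  -- Step 3: one ambient group `G = Gal(K[q]/K)`, `H = Gal(K[q]/K[1])`, `ρ = pointGalHom ∘ incl`
  have hle : ringClassGalOver ι (1 * q) 1 ≤ ringClassGal ι (1 * q) :=
    ringClassGalOver_le_ringClassGal ι (1 * q) 1
  have hrelH : ∑ h : (ringClassGalOver ι (1 * q) 1).subgroupOf (ringClassGal ι (1 * q)),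
      ((pointGalHom W (ringClassField K ι (1 * q))).comp (ringClassGal ι (1 * q)).subtype)
        (h : ringClassGal ι (1 * q)) y = (W.frobeniusTrace q) • y₁ := by
    rw [← hrelL]
    exact Fintype.sum_equiv (Subgroup.subgroupOfEquivOfLe hle).toEquiv _ _ (fun h => rfl)
  -- Step 4: fold to the total trace (coset decomposition) and insert Gross's (4.1)
  have htrρ := GenusCongruence.sum_eq_smul_sum_quotient_of_trace_eq_smul
    ((pointGalHom W (ringClassField K ι (1 * q))).comp (ringClassGal ι (1 * q)).subtype) _ hrelH
  simp only [MonoidHom.comp_apply, Subgroup.coe_subtype] at htrρ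
  rw [hyK] at htrρ
  -- Step 5: the parity transport
  exact GenusCongruence.not_isOfFinAddOrder_genusPoint
    (fun g : ringClassGal ι (1 * q) => pointGalHom W (ringClassField K ι (1 * q)) g.1)
    h2L hyfix hndiv s haq htrρ

/-! ## The generic ring-class consumer: any conductor `n`, composed trace as a binder -/

/-- **`P(s) ∉ E(K[n])_tors` from the COMPOSED trace relation, any conductor `n`.** For `K` imaginary
quadratic, `n ≠ 0`, `y ∈ E(K[n])`, `y_K ∈ E(K)`: if `Σ_{σ ∈ Gal(K[n]/K)} σy = m·y_K` with `m` ODD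
(for square-free `n` supported on INERT `a_q`-odd primes this is the printed composed relation
`Tr_{K_n/K} y_n = a_n · y_K`, `a_n = ∏ a_q` — Bradshaw–Stein 2012 §3 / CLTZ 2015 (h9) — or the
one-step relations folded by `GenusCongruence` §3), `E(K[n])[2] = 0` (L1, binder) and (H-y)
`y_K ∉ 2E(K)`, then for every sign function `s` on `Gal(K[n]/K)` the point `Σ_σ s(σ)·σy` has infinite
order. (`GenusCongruence.not_isOfFinAddOrder_genusPoint` + the bridge lemmas of this file.) [folklore] -/
theorem genusPoint_not_isOfFinAddOrder_of_trace
    (W : WeierstrassCurve ℚ) {K : Type} [Field K] [NumberField K] (hK : IsImaginaryQuadratic K)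
    (ι : K →+* ℂ) {n : ℕ} (hn : n ≠ 0) [NumberField (ringClassField K ι n)]
    (y : (W.baseChange (ringClassField K ι n : Type)).toAffine.Point)
    (yK : (W.baseChange K).toAffine.Point) {m : ℤ} (hm : Odd m)
    (htr : ∑ σ : ringClassGal ι n, pointGalHom W (ringClassField K ι n) σ.1 y =
      m • WeierstrassCurve.Affine.Point.map (W' := W)
        (algebraMap K (ringClassField K ι n)).toRatAlgHom yK)
    (h2L : ∀ Q : (W.baseChange (ringClassField K ι n : Type)).toAffine.Point,
      (2 : ℕ) • Q = 0 → Q = 0)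
    (hHy : ¬ ∃ R : (W.baseChange K).toAffine.Point, (2 : ℕ) • R = yK)
    (s : ringClassGal ι n → ℤˣ) :
    ¬ IsOfFinAddOrder (∑ σ : ringClassGal ι n, (s σ : ℤ) •
      pointGalHom W (ringClassField K ι n) σ.1 y) :=
  GenusCongruence.not_isOfFinAddOrder_genusPoint
    (fun g : ringClassGal ι n => pointGalHom W (ringClassField K ι n) g.1) h2L
    (fun g => pointGalHom_map_eq_of_mem_ringClassGal ι n W g.2 yK)
    (not_exists_fixed_two_nsmul_eq ι n W hK hn yK hHy) s hm htr

end Summit.BirchSwinnertonDyer.Uniform.U2.RingClass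

end
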